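import Literature.Analysis.InnerProduct.RestrictedHilbertTensorRep
import Mathlib.Topology.Algebra.RestrictedProduct.TopologicalSpace
import Mathlib.Analysis.Complex.Circle

/-!
# The restricted Hilbert tensor product, VI: strong continuity of `⊗′_i ρ_i` on the restricted product

Topic `Analysis/InnerProduct`; continues `RestrictedHilbertTensorRep` (the representation
`rep hρ : Πʳ_i [G_i, B_i] →* U(⊗′_i (H_i, e_i))` of §4 there, `inner_tp_rep_tp`).

* §1 UNITARY REPRESENTATIONS, GENERAL LEMMAS (Deitmar–Echterhoff, *Principles of Harmonic Analysis*, Lemma 6.1.1,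
  PDF p. 173 [DeitmarEchterhoff2014]: a homomorphism `π : G → GL(V)` is a (jointly continuous) representation iff
  every orbit map is continuous at `g = 1` and `‖π(g)‖` is locally bounded — automatic for isometries). For a
  homomorphism `π : K →* (E ≃ₗᵢ[ℂ] E)` into the linear isometric automorphisms of a normed space:
  **`continuous_apply_of_continuousAt_one`** (orbit map continuous at `1` ⇒ continuous), on an inner product space
  **`continuousAt_one_apply_of_inner`** (the diagonal coefficient `k ↦ ⟪v, π k v⟫` continuous at `1` ⇒ the orbit
  map of `v` is, by `‖π(k)v - v‖² = 2‖v‖² - 2 re ⟪v, π(k)v⟫`), **`continuous_apply_of_dense`** (orbit maps of a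
  TOTAL set of vectors continuous at `1` ⇒ all orbit maps continuous: the good vectors form a submodule closed under
  locally uniform approximation), **`continuous_uncurry_of_isometry`** (strong ⇒ joint continuity); and the scalar
  unitary representation **`scalarRep c`** `= (g ↦ c(g) • id)` of a unitary character `c : G →* Circle`
  (`unitScalar`, `continuous_scalarRep_apply`).
* §2 STRONG CONTINUITY OF `⊗′ρ` (the unitary counterpart of the restricted tensor product representation
  `(⊗_v ρ_v)(g) ⊗ξ_v = ⊗_v ρ_v(g_v) ξ_v` of a restricted direct product, Bump (1997) §3.3, PDF p. 294 [Bump1997];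
  Flath (1979) [FlathCorvallis1979]): if every `B_i` is an OPEN subgroup of the topological group `G_i` and every
  `ρ_i` is strongly continuous, then `k ↦ (⊗′ρ)(k) v` is continuous on `Πʳ_i [G_i, B_i]` with Mathlib's
  restricted-product topology for every `v` (**`continuous_rep`**; `continuous_inner_rep`, `continuous_rep_uncurry`).
  Proof: for a pure tensor `⊗x` the diagonal coefficient `k ↦ ⟪⊗x, (⊗′ρ)(k) ⊗x⟫ = ∏ᶠ_i ⟪x_i, ρ_i(k_i) x_i⟫` is, on
  the open box `∏_i B_i ↪ Πʳ` (`RestrictedProduct.nhds_eq_map_structureMap`), a FINITE product of continuous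
  functions (outside the finite set where `x_i ≠ e_i` or `B_i` may move `e_i` each factor is `⟪e_i, e_i⟫ = 1`), hence
  continuous at `1` (**`continuousAt_one_inner_rep_tp`**); then §1.

Everything is proved (Mathlib only); no instances.

## References

* A. Deitmar, S. Echterhoff, *Principles of Harmonic Analysis*, 2nd ed., Universitext (2014), Lemma 6.1.1
  [DeitmarEchterhoff2014] (held: `book:deitmar2014-principles-harmonic-analysis`, PDF p. 173).
* D. Bump, *Automorphic Forms and Representations* (1997), §3.3 [Bump1997] (held:
  `book:bump1997-automorphic-forms-representations`, PDF pp. 293–294).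
* D. Flath, *Decomposition of representations into tensor products*, Corvallis (1979) [FlathCorvallis1979].

## Provenance

Reproduced for the tree under the LEAN-IN-TREE rule (2026-08-18) from the pub-hodgecm cell's package files
`HodgeCM/PerL34/GenuineTensorModel.lean` §A (DAG-node prover #09 lineage, seat pv09-g6, gate run 29) and
`HodgeCM/PerL34/GenuineTensorContinuity.lean` §§A–B (seat pv09-g6, gate run 29), verbatim up to the namespace
(`HodgeCM.PerL34.RestrictedTensor` ↦ `Literature.Analysis.InnerProduct.RestrictedTensor`) and the added docstrings;
§C of the latter (the genuine torus model of a CM field) is summit-side and is NOT reproduced. Ported by seat pv09-g9.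
-/

set_option autoImplicit false

noncomputable section

open Function Set Filter Topology
open scoped InnerProductSpace ComplexConjugate RestrictedProduct

namespace Literature.Analysis.InnerProduct.RestrictedTensor

/-! ## §1 Unitary representations: strong continuity from continuity at `1`; scalar representations -/

section Unitary

variable {G : Type*} [Group G] {E : Type*} [NormedAddCommGroup E] [NormedSpace ℂ E]

/-- A representation by linear isometric automorphisms whose orbit map `g ↦ ρ(g) v` is continuous at `1` has a
continuous orbit map (Deitmar–Echterhoff Lemma 6.1.1, isometric case). [cite: DeitmarEchterhoff2014, Lemma 6.1.1] -/
theorem continuous_apply_of_continuousAt_one [TopologicalSpace G] [ContinuousMul G]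
    (ρ : G →* (E ≃ₗᵢ[ℂ] E)) (v : E)
    (h : ContinuousAt (fun g => ρ g v) 1) : Continuous fun g => ρ g v := by
  refine continuous_iff_continuousAt.2 fun g₀ => ?_
  have hm : ContinuousAt (fun g : G => g₀⁻¹ * g) g₀ := (continuous_const.mul continuous_id).continuousAt
  have h1 : ContinuousAt (fun g => ρ g v) (g₀⁻¹ * g₀) := by rwa [inv_mul_cancel]
  have hc : ContinuousAt (fun g => ρ g₀ (ρ (g₀⁻¹ * g) v)) g₀ :=
    (ρ g₀).continuous.continuousAt.comp (ContinuousAt.comp h1 hm)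
  refine hc.congr (Eventually.of_forall fun g => ?_)
  change ρ g₀ (ρ (g₀⁻¹ * g) v) = ρ g v
  rw [← Function.comp_apply (f := ρ g₀), ← LinearIsometryEquiv.coe_mul, ← map_mul, mul_inv_cancel_left]


/-- Multiplication by a unit complex number, as a linear isometric equivalence. [folklore] -/
def unitScalar (z : Circle) : E ≃ₗᵢ[ℂ] E where
  toFun v := (z : ℂ) • v
  map_add' := smul_add _
  map_smul' c v := smul_comm _ _ _
  invFun v := ((z⁻¹ : Circle) : ℂ) • v
  left_inv v := by
    simp only [smul_smul, ← Circle.coe_mul, inv_mul_cancel, Circle.coe_one, one_smul]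
  right_inv v := by
    simp only [smul_smul, ← Circle.coe_mul, mul_inv_cancel, Circle.coe_one, one_smul]
  norm_map' v := by
    change ‖(z : ℂ) • v‖ = ‖v‖
    rw [norm_smul, Circle.norm_coe, one_mul]

/-- `unitScalar z v = z • v`. [folklore] -/
@[simp] theorem unitScalar_apply (z : Circle) (v : E) : unitScalar z v = (z : ℂ) • v := rfl

/-- **The scalar unitary representation** `g ↦ c(g) · id` of a unitary character `c` (Deitmar–Echterhoff,
Examples 6.1.2). [folklore] -/
def scalarRep (c : G →* Circle) : G →* (E ≃ₗᵢ[ℂ] E) where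
  toFun g := unitScalar (c g)
  map_one' := LinearIsometryEquiv.ext fun v => by
    rw [unitScalar_apply, map_one, Circle.coe_one, one_smul]; rfl
  map_mul' g h := LinearIsometryEquiv.ext fun v => by
    rw [unitScalar_apply, map_mul, Circle.coe_mul, mul_smul, LinearIsometryEquiv.coe_mul,
      Function.comp_apply, unitScalar_apply, unitScalar_apply]

/-- `scalarRep c g v = c g • v`. [folklore] -/
@[simp] theorem scalarRep_apply (c : G →* Circle) (g : G) (v : E) : scalarRep c g v = (c g : ℂ) • v := rfl

/-- The scalar representation of a continuous unitary character is strongly continuous. [folklore] -/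
theorem continuous_scalarRep_apply [TopologicalSpace G] (c : G →* Circle) (hc : Continuous c) (v : E) :
    Continuous fun g => scalarRep (E := E) c g v := by
  change Continuous fun g => ((c g : Circle) : ℂ) • v
  exact (continuous_subtype_val.comp hc).smul continuous_const

end Unitary

section UnitaryHilbert

variable {K : Type*} [TopologicalSpace K] [Group K]
  {E : Type*} [NormedAddCommGroup E] [InnerProductSpace ℂ E]

/-- For a representation by isometries, the orbit map of `v` is continuous at `1` as soon as the diagonal
matrix coefficient `k ↦ ⟪v, π(k) v⟫` is (`‖π(k)v - v‖² = 2‖v‖² - 2 re ⟪v, π(k)v⟫`). [folklore] -/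
theorem continuousAt_one_apply_of_inner (π : K →* (E ≃ₗᵢ[ℂ] E)) (v : E)
    (h : ContinuousAt (fun k => ⟪v, π k v⟫_ℂ) 1) : ContinuousAt (fun k => π k v) 1 := by
  have h1 : π 1 v = v := by rw [map_one]; rfl
  have hsq : ∀ k, ‖π k v - v‖ ^ 2 = 2 * ‖v‖ ^ 2 - 2 * RCLike.re ⟪v, π k v⟫_ℂ := fun k => by
    rw [@norm_sub_sq ℂ, LinearIsometryEquiv.norm_map, ← inner_conj_symm, RCLike.conj_re]; ring
  have h2 : Tendsto (fun k => RCLike.re ⟪v, π k v⟫_ℂ) (𝓝 1) (𝓝 (‖v‖ ^ 2)) := by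
    have := RCLike.continuous_re.continuousAt.tendsto.comp h
    simp only [Function.comp_def, h1, inner_self_eq_norm_sq] at this
    exact this
  have h3 := (tendsto_const_nhds (x := 2 * ‖v‖ ^ 2) (f := 𝓝 (1 : K))).sub (h2.const_mul 2)
  rw [sub_self] at h3
  have h4 := h3.sqrt
  rw [Real.sqrt_zero] at h4
  change Tendsto (fun k => π k v) (𝓝 1) (𝓝 (π 1 v))
  rw [h1, tendsto_iff_norm_sub_tendsto_zero]
  refine h4.congr fun k => ?_
  rw [← hsq, Real.sqrt_sq (norm_nonneg _)]

/-- For a representation by isometries of a group with continuous multiplication: if the orbit maps of a TOTAL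
set of vectors are continuous at `1`, every orbit map is continuous. [folklore] -/
theorem continuous_apply_of_dense [ContinuousMul K] (π : K →* (E ≃ₗᵢ[ℂ] E)) {D : Set E}
    (hD : Dense ((Submodule.span ℂ D : Submodule ℂ E) : Set E))
    (h : ∀ v ∈ D, ContinuousAt (fun k => π k v) 1) (v : E) : Continuous fun k => π k v := by
  let M : Submodule ℂ E :=
    { carrier := {v | ContinuousAt (fun k => π k v) 1}
      add_mem' := fun {a b} ha hb => by
        simp only [Set.mem_setOf_eq, map_add] at ha hb ⊢
        exact ha.add hb
      zero_mem' := by simp only [Set.mem_setOf_eq, map_zero]; exact continuousAt_const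
      smul_mem' := fun c a ha => by
        simp only [Set.mem_setOf_eq, map_smul] at ha ⊢
        exact ha.const_smul c }
  have hM : Submodule.span ℂ D ≤ M := Submodule.span_le.mpr fun w hw => h w hw
  have hdense : Dense (M : Set E) := hD.mono hM
  refine continuous_apply_of_continuousAt_one π v ?_
  refine continuousAt_of_locally_uniform_approx_of_continuousAt fun u hu => ?_
  obtain ⟨ε, hε, hεu⟩ := Metric.mem_uniformity_dist.mp hu
  obtain ⟨w, hwM, hw⟩ := hdense.exists_dist_lt v hε
  refine ⟨univ, univ_mem, fun k => π k w, hwM, fun k _ => hεu ?_⟩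
  rw [dist_eq_norm, ← map_sub, LinearIsometryEquiv.norm_map, ← dist_eq_norm]
  exact hw

/-- For a representation by isometries, strong continuity is JOINT continuity of `(k, v) ↦ π(k) v`
(`‖π(k)v - π(k₀)v₀‖ ≤ ‖v - v₀‖ + ‖π(k)v₀ - π(k₀)v₀‖`). [folklore] -/
theorem continuous_uncurry_of_isometry (π : K →* (E ≃ₗᵢ[ℂ] E)) (h : ∀ v, Continuous fun k => π k v) :
    Continuous fun p : K × E => π p.1 p.2 := by
  refine continuous_iff_continuousAt.2 ?_
  rintro ⟨k₀, v₀⟩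
  rw [ContinuousAt, tendsto_iff_norm_sub_tendsto_zero]
  show Tendsto (fun p : K × E => ‖π p.1 p.2 - π k₀ v₀‖) (𝓝 (k₀, v₀)) (𝓝 0)
  have ha' : Continuous fun p : K × E => p.2 - v₀ := continuous_snd.sub continuous_const
  have hb' : Continuous fun p : K × E => π p.1 v₀ - π k₀ v₀ := ((h v₀).comp continuous_fst).sub continuous_const
  have ha : Tendsto (fun p : K × E => ‖p.2 - v₀‖) (𝓝 (k₀, v₀)) (𝓝 0) := by
    simpa using ha'.norm.tendsto (k₀, v₀)
  have hb : Tendsto (fun p : K × E => ‖π p.1 v₀ - π k₀ v₀‖) (𝓝 (k₀, v₀)) (𝓝 0) := by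
    simpa using hb'.norm.tendsto (k₀, v₀)
  refine squeeze_zero (fun _ => norm_nonneg _) (fun p => ?_) (by simpa using ha.add hb)
  calc ‖π p.1 p.2 - π k₀ v₀‖ = ‖π p.1 (p.2 - v₀) + (π p.1 v₀ - π k₀ v₀)‖ := by
        rw [map_sub]; congr 1; abel
    _ ≤ ‖π p.1 (p.2 - v₀)‖ + ‖π p.1 v₀ - π k₀ v₀‖ := norm_add_le _ _
    _ = ‖p.2 - v₀‖ + ‖π p.1 v₀ - π k₀ v₀‖ := by rw [LinearIsometryEquiv.norm_map]

end UnitaryHilbert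

/-! ## §2 `⊗′ρ` is strongly continuous on the restricted product -/

section Continuity

universe u v

variable {ι : Type u} {H : ι → Type v} [∀ i, NormedAddCommGroup (H i)] [∀ i, InnerProductSpace ℂ (H i)]
  {𝓔 : UnitFamily H}
  {G : ι → Type*} [∀ i, Group (G i)] {Sub : ι → Type*} [∀ i, SetLike (Sub i) (G i)]
  [∀ i, SubgroupClass (Sub i) (G i)] {B : ∀ i, Sub i} {ρ : ∀ i, G i →* (H i ≃ₗᵢ[ℂ] H i)}
  (hρ : Admissible 𝓔 B ρ) [∀ i, TopologicalSpace (G i)]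

/-- The diagonal coefficient `k ↦ ⟪⊗x, (⊗′ρ)(k) ⊗x⟫` of a pure tensor is continuous at `1` (all `B_i` open, all
`ρ_i` strongly continuous): on the open box `∏ B_i` it is a finite product of local coefficients. [folklore] -/
theorem continuousAt_one_inner_rep_tp (hBopen : ∀ i, IsOpen (B i : Set (G i)))
    (hcont : ∀ i (w : H i), Continuous fun g : G i => ρ i g w) (x : RVec 𝓔) :
    ContinuousAt (fun k : Πʳ i, [G i, B i] => ⟪tp 𝓔 x, rep hρ k (tp 𝓔 x)⟫_ℂ) 1 := by
  classical
  -- the finite set of indices where `x_i ≠ e_i` or `B_i` might move `e_i`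
  have hE : Set.Finite {i | ¬ ∀ b ∈ B i, ρ i b (𝓔.e i) = 𝓔.e i} := by
    have h := hρ
    rwa [Admissible, Filter.eventually_cofinite] at h
  let T : Finset ι := (x.finite_ne.union hE).toFinset
  -- the open box `∏ B_i` and its identity point
  let A : ∀ i, Set (G i) := fun i => (B i : Set (G i))
  let e : ∀ i, A i := fun i => ⟨1, one_mem (B i)⟩
  have he : RestrictedProduct.structureMap G A cofinite e = (1 : Πʳ i, [G i, B i]) := by
    ext i
    rfl
  -- on the box the coefficient is a finite product of continuous functions
  let cb : (∀ i, A i) → ℂ := fun b => ∏ i ∈ T, ⟪x i, ρ i (b i : G i) (x i)⟫_ℂ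
  have hcb : Continuous cb :=
    continuous_finsetProd T fun i _ =>
      continuous_const.inner ((hcont i (x i)).comp (continuous_subtype_val.comp (continuous_apply i)))
  have hcomp : (fun k : Πʳ i, [G i, B i] => ⟪tp 𝓔 x, rep hρ k (tp 𝓔 x)⟫_ℂ) ∘
      RestrictedProduct.structureMap G A cofinite = cb := by
    funext b
    rw [Function.comp_apply, inner_tp_rep_tp]
    change (∏ᶠ i, ⟪x i, ρ i (b i : G i) (x i)⟫_ℂ) = ∏ i ∈ T, ⟪x i, ρ i (b i : G i) (x i)⟫_ℂ
    refine finprod_eq_prod_of_mulSupport_subset _ fun i hi => ?_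
    rw [Function.mem_mulSupport] at hi
    rw [Set.Finite.coe_toFinset]
    by_contra hnot
    rw [Set.mem_union, not_or, Set.mem_setOf_eq, Set.mem_setOf_eq, not_not, not_not] at hnot
    exact hi (by rw [hnot.1, hnot.2 _ (b i).2, inner_e_e])
  have h1 : ⟪tp 𝓔 x, rep hρ (RestrictedProduct.structureMap G A cofinite e) (tp 𝓔 x)⟫_ℂ = cb e :=
    congr_fun hcomp e
  -- transfer through the open embedding of the box
  rw [ContinuousAt, ← he, RestrictedProduct.nhds_eq_map_structureMap hBopen e, Filter.tendsto_map'_iff, hcomp,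
    h1]
  exact hcb.continuousAt

/-- **Strong continuity of `⊗′ρ`.**  If every `B_i` is an open subgroup and every `ρ_i` is strongly continuous,
then `k ↦ (⊗′ρ)(k) v` is continuous on `Πʳ_i [G_i, B_i]` for every `v ∈ ⊗′_i (H_i, e_i)`. [folklore] -/
theorem continuous_rep [∀ i, ContinuousMul (G i)] (hBopen : ∀ i, IsOpen (B i : Set (G i)))
    (hcont : ∀ i (w : H i), Continuous fun g : G i => ρ i g w) (v : Space 𝓔) :
    Continuous fun k : Πʳ i, [G i, B i] => rep hρ k v := by
  haveI : Fact (∀ i, IsOpen (B i : Set (G i))) := ⟨hBopen⟩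
  refine continuous_apply_of_dense (rep hρ) dense_span_tp (fun w hw => ?_) v
  obtain ⟨x, rfl⟩ := hw
  exact continuousAt_one_apply_of_inner (rep hρ) (tp 𝓔 x) (continuousAt_one_inner_rep_tp hρ hBopen hcont x)

/-- hence every matrix coefficient `k ↦ ⟪u, (⊗′ρ)(k) v⟫` is continuous. [folklore] -/
theorem continuous_inner_rep [∀ i, ContinuousMul (G i)] (hBopen : ∀ i, IsOpen (B i : Set (G i)))
    (hcont : ∀ i (w : H i), Continuous fun g : G i => ρ i g w) (u v : Space 𝓔) :
    Continuous fun k : Πʳ i, [G i, B i] => ⟪u, rep hρ k v⟫_ℂ :=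
  continuous_const.inner (continuous_rep hρ hBopen hcont v)

/-- joint continuity `(k, v) ↦ (⊗′ρ)(k) v`. [folklore] -/
theorem continuous_rep_uncurry [∀ i, ContinuousMul (G i)] (hBopen : ∀ i, IsOpen (B i : Set (G i)))
    (hcont : ∀ i (w : H i), Continuous fun g : G i => ρ i g w) :
    Continuous fun p : (Πʳ i, [G i, B i]) × Space 𝓔 => rep hρ p.1 p.2 :=
  continuous_uncurry_of_isometry (rep hρ) (continuous_rep hρ hBopen hcont)

end Continuity

end Literature.Analysis.InnerProduct.RestrictedTensor
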